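import Mathlib
import HarnessLib
import Summits.HubbardSuperconductivity.HubbardSuperconductivity.Theorems.KLProgrammeKLRegimeTwoVolumeResummedSymbolKernels

/-!
# K3 two-volume read-out at the BARE frame `K = 0` (flowing scheme, scale `0`: `K₀ = klFlowFrameU … 0 = 0`): the explicit-symbol numbers
# of k3c5-p2's `abs_klLocalPart_sub_le_resummed` / `…_of_copiesStep` are `‖τ̌‖₁ = 1`, `M₁(τ̌) = 0`, `far|c_{Re E}| = 0` — EXACTLY

Cell gate-hubbard-kl, seat hubbard-kl-k3c5-p1 (g8).  Companion of `…TwoVolumeResummedSymbolKernels` (general frame: resolvent bounds) for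
the one instance the gen-8 engine child `KLRegimeEngineV17F2` reads at scale `0` (`stub_twoLeg_scale0` at `K₀ = 0`): with `K = 0` the resummed
symbols are `τ ≡ 1` and `E ≡ 0` for EVERY `u`, so the torus position kernel of `τ` is `δ₀` and that of `E` (and of `Re E`) vanishes:

* `tau_frameZero`, `E_frameZero` — the lattice data at `K = 0`;
* **`sum_norm_torusFourierInv_tau_frameZero`** `= 1`, **`sum_tnorm_norm_torusFourierInv_tau_frameZero`** `= 0`,
  **`torusCosCoeff_re_E_frameZero`** `= 0` (hence every far-tail sum of it is `0`, `sum_abs_torusCosCoeff_re_E_frameZero`).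

Proofs only; no definitions; nothing about the model.
-/

noncomputable section

namespace Summit.HubbardSuperconductivity.HubbardSuperconductivity.Theorems.TwoVolumeDefect

set_option linter.dupNamespace false -- summit = problem name (single-conjunct summit), D-0017

open Finset Complex Literature.MathematicalPhysics.QuantumLattice Literature.Probability.LatticeModels
open Summit.HubbardSuperconductivity.HubbardSuperconductivity.Theorems.KLRegimeSplit
open scoped ComplexConjugate

variable {L : ℕ} [NeZero L] (u : (Fin 2 → ℝ) → ℂ)

omit [NeZero L] in
/-- At the bare frame the symbol `τ` is identically `1` on the lattice. -/
theorem tau_frameZero (k : TorusSite 2 L) :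
    (1 - ((0 : TrigPolyC4v).eval (latticeMomentum L k) : ℂ) *
        (u (latticeMomentum L k) / (1 + u (latticeMomentum L k) * (0 : TrigPolyC4v).eval (latticeMomentum L k)))) ^ 2 = 1 := by
  simp

omit [NeZero L] in
/-- At the bare frame the symbol `E` is identically `0` on the lattice. -/
theorem E_frameZero (k : TorusSite 2 L) :
    ((0 : TrigPolyC4v).eval (latticeMomentum L k) : ℂ) -
        ((0 : TrigPolyC4v).eval (latticeMomentum L k) : ℂ) ^ 2 *
          (u (latticeMomentum L k) / (1 + u (latticeMomentum L k) * (0 : TrigPolyC4v).eval (latticeMomentum L k))) = 0 := by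
  simp

/-- **`‖τ̌‖₁ = 1` at `K = 0`.** -/
theorem sum_norm_torusFourierInv_tau_frameZero :
    ∑ x : TorusSite 2 L, ‖torusFourierInv (fun k => (1 - ((0 : TrigPolyC4v).eval (latticeMomentum L k) : ℂ) *
        (u (latticeMomentum L k) / (1 + u (latticeMomentum L k) * (0 : TrigPolyC4v).eval (latticeMomentum L k)))) ^ 2) x‖ = 1 := by
  have h : (fun k : TorusSite 2 L => (1 - ((0 : TrigPolyC4v).eval (latticeMomentum L k) : ℂ) *
      (u (latticeMomentum L k) / (1 + u (latticeMomentum L k) * (0 : TrigPolyC4v).eval (latticeMomentum L k)))) ^ 2) =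
      fun _ => (1 : ℂ) := funext fun k => tau_frameZero u k
  rw [h, sum_norm_torusFourierInv_const_one]

/-- **`M₁(τ̌) = 0` at `K = 0`.** -/
theorem sum_tnorm_norm_torusFourierInv_tau_frameZero :
    ∑ x : TorusSite 2 L, (Torus.tnorm x : ℝ) * ‖torusFourierInv (fun k => (1 - ((0 : TrigPolyC4v).eval (latticeMomentum L k) : ℂ) *
        (u (latticeMomentum L k) / (1 + u (latticeMomentum L k) * (0 : TrigPolyC4v).eval (latticeMomentum L k)))) ^ 2) x‖ = 0 := by
  have h : (fun k : TorusSite 2 L => (1 - ((0 : TrigPolyC4v).eval (latticeMomentum L k) : ℂ) *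
      (u (latticeMomentum L k) / (1 + u (latticeMomentum L k) * (0 : TrigPolyC4v).eval (latticeMomentum L k)))) ^ 2) =
      fun _ => (1 : ℂ) := funext fun k => tau_frameZero u k
  rw [h, sum_tnorm_norm_torusFourierInv_const_one]

/-- **The cosine coefficients of `Re E` vanish at `K = 0`.** -/
theorem torusCosCoeff_re_E_frameZero (y : TorusSite 2 L) :
    torusCosCoeff L (fun k => (((0 : TrigPolyC4v).eval (latticeMomentum L k) : ℂ) -
        ((0 : TrigPolyC4v).eval (latticeMomentum L k) : ℂ) ^ 2 *
          (u (latticeMomentum L k) / (1 + u (latticeMomentum L k) * (0 : TrigPolyC4v).eval (latticeMomentum L k)))).re) y = 0 := by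
  have h : (fun k : TorusSite 2 L => (((0 : TrigPolyC4v).eval (latticeMomentum L k) : ℂ) -
      ((0 : TrigPolyC4v).eval (latticeMomentum L k) : ℂ) ^ 2 *
        (u (latticeMomentum L k) / (1 + u (latticeMomentum L k) * (0 : TrigPolyC4v).eval (latticeMomentum L k)))).re) =
      fun _ => (0 : ℝ) := funext fun k => by rw [E_frameZero u k]; simp
  rw [h]
  simp [torusCosCoeff]

/-- Hence every (far-tail or other) sum of `|c_{Re E}|` vanishes at `K = 0`. -/
theorem sum_abs_torusCosCoeff_re_E_frameZero (s : Finset (TorusSite 2 L)) :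
    ∑ y ∈ s, |torusCosCoeff L (fun k => (((0 : TrigPolyC4v).eval (latticeMomentum L k) : ℂ) -
        ((0 : TrigPolyC4v).eval (latticeMomentum L k) : ℂ) ^ 2 *
          (u (latticeMomentum L k) / (1 + u (latticeMomentum L k) * (0 : TrigPolyC4v).eval (latticeMomentum L k)))).re) y| = 0 :=
  Finset.sum_eq_zero fun y _ => by rw [torusCosCoeff_re_E_frameZero]; simp

end Summit.HubbardSuperconductivity.HubbardSuperconductivity.Theorems.TwoVolumeDefect

end
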